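import Literature.Analysis.SpecialFunctions.DigammaLogBound
import Mathlib.Analysis.SumIntegralComparisons
import HarnessLib

/-!
# Format C analysis layer (D1): the imaginary part of `ψ` on the right half-plane — two-sided `arctan` bound

Route context: the Fourier–Galerkin / Schur-complement certificates of Weil positivity on a window
("format C", cell memo `run/shared/lean/pub/rh-explicit/rh-explicit-weil-10/FORMATC-DESIGN.md` §4.1 (D1);
sibling files `WeilFormatCSchurStep.lean`, `WeilFormatCPhantomCoercivity.lean`), supporting
stmt-RiemannHypothesis-0098.  This file is pure special-function analysis with no Weil-specific objects;
it sits here rather than under `Literature/` because the inequality below is our own statement (a routine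
series–integral comparison), not a cited printed theorem.

Companion of `Literature/Analysis/SpecialFunctions/DigammaLogBound.lean`, which proves
`Im ψ(w) = Im w · Σ_{k ≥ 0} ‖w + k‖⁻²` (`hasSum_im_digamma`) and the UPPER bound
`|Im ψ(w)| ≤ |Im w|/‖w‖² + π/2`.  Here we add the matching LOWER bound, by comparing the series with
the integral `∫₀^∞ Im w du /((Re w + u)² + (Im w)²) = π/2 − arctan (Re w / Im w)` from below
(the summand is antitone in `k` because `Re w > 0`):

* `WeilFormatC.pi_div_two_sub_arctan_le_im_digamma` —
  **`π/2 − arctan (Re w / Im w) ≤ Im ψ(w)`** for `0 < Re w`, `0 < Im w`;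
* `WeilFormatC.im_digamma_le_pi_div_two_add` — the upper bound in the
  same shape, `Im ψ(w) ≤ π/2 + Im w/‖w‖²` (restated from `abs_im_digamma_le`);
* `WeilFormatC.abs_im_digamma_sub_pi_div_two_le` — for `0 < Re w ≤ 1`,
  `0 < Im w`: **`|Im ψ(w) − π/2| ≤ 1/Im w`** (uses `arctan t ≤ t ≤ tan t`-type monotonicity).

The last form, at `Re w = 1/4`, is the edge-value bound `|Im ψ(¼ + iy) − π/2| ≤ 1/y` consumed by the
Fourier–Galerkin (Yoshida 1992 §§5–6) treatment of Weil's explicit-formula functional on a window: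
the off-diagonal archimedean Gram entries are `(a/(π(n−m)))·(Im ψ(¼ + iω_n/2) − Im ψ(¼ + iω_m/2))`
[Yoshida 1992, (5.16)], and their column asymptotics need exactly this first-order control of
`Im ψ` at large height.  Everything here is proved; there are no named facts.

## References

* G. E. Andrews, R. Askey, R. Roy, *Special Functions*, CUP 1999, Thm. 1.2.5, (1.2.13) (the series).
* H. Yoshida, *On Hermitian forms attached to zeta functions*, Adv. Stud. Pure Math. 21 (1992),
  281–325, §5 (where these digamma values enter).
-/

-- `Summit.RiemannHypothesis.RiemannHypothesis.…` is the layout-mandated namespace (summit = problem name).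
set_option linter.dupNamespace false

noncomputable section

open Filter Set MeasureTheory intervalIntegral
open scoped Real Topology

namespace Summit.RiemannHypothesis.RiemannHypothesis.Theorems.WeilFormatC

open Complex Literature.Analysis.SpecialFunctions.Complex

/-- The integral kernel: for `y ≠ 0`,
`∫₀^A y du/((x+u)² + y²) = arctan((x+A)/y) − arctan(x/y)`. [folklore] -/
theorem integral_im_div_sq_add_sq {x y A : ℝ} (hy : y ≠ 0) (_hA : 0 ≤ A) :
    ∫ u in (0 : ℝ)..A, y / ((x + u) ^ 2 + y ^ 2)
      = Real.arctan ((x + A) / y) - Real.arctan (x / y) := by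
  have hderiv : ∀ u ∈ uIcc 0 A,
      HasDerivAt (fun u : ℝ ↦ Real.arctan ((x + u) / y)) (y / ((x + u) ^ 2 + y ^ 2)) u := by
    intro u _
    have h1 : HasDerivAt (fun u : ℝ ↦ (x + u) / y) (1 / y) u := by
      simpa using ((hasDerivAt_id u).const_add x).div_const y
    have h2 := (Real.hasDerivAt_arctan ((x + u) / y)).comp u h1
    refine h2.congr_deriv ?_
    have hpos : (x + u) ^ 2 + y ^ 2 ≠ 0 := by positivity
    field_simp
    ring
  have hcont : ContinuousOn (fun u : ℝ ↦ y / ((x + u) ^ 2 + y ^ 2)) (uIcc 0 A) := by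
    refine ContinuousOn.div continuousOn_const (by fun_prop) fun u _ ↦ ?_
    positivity
  rw [integral_eq_sub_of_hasDerivAt hderiv hcont.intervalIntegrable]
  simp

/-- Integral comparison from below for the series of `Im ψ`: for `0 < x`, `0 < y` and every `n`,
`arctan((x+n)/y) − arctan(x/y) ≤ Σ_{k<n} y/((x+k)² + y²)`. [folklore] -/
theorem arctan_sub_arctan_le_sum {x y : ℝ} (hx : 0 < x) (hy : 0 < y) (n : ℕ) :
    Real.arctan ((x + n) / y) - Real.arctan (x / y)
      ≤ ∑ k ∈ Finset.range n, y / ((x + k) ^ 2 + y ^ 2) := by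
  set f : ℝ → ℝ := fun u ↦ y / ((x + u) ^ 2 + y ^ 2) with hf
  have hanti : AntitoneOn f (Icc ((0 : ℕ) : ℝ) ((n : ℕ) : ℝ)) := by
    intro u hu v _ huv
    simp only [hf]
    have hu0 : (0 : ℝ) ≤ u := by exact_mod_cast hu.1
    have hpos : 0 < (x + u) ^ 2 + y ^ 2 := by positivity
    gcongr
  have h := AntitoneOn.integral_le_sum_Ico (Nat.zero_le n) hanti
  rw [Finset.range_eq_Ico]
  refine le_trans (le_of_eq ?_) h
  push_cast
  rw [hf, integral_im_div_sq_add_sq hy.ne' (Nat.cast_nonneg n)]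

/-- **Lower bound for `Im ψ` on the right half-plane.** For `0 < Re w` and `0 < Im w`,
`π/2 − arctan (Re w / Im w) ≤ Im ψ(w)`.  Proof: `Im ψ(w) = Σ_{k≥0} Im w/((Re w + k)² + (Im w)²)`
(`hasSum_im_digamma`), the summand is antitone in `k`, so every partial sum dominates
`∫₀ⁿ = arctan((Re w + n)/Im w) − arctan(Re w/Im w)`, whose limit is `π/2 − arctan(Re w/Im w)`. [folklore] -/
theorem pi_div_two_sub_arctan_le_im_digamma {w : ℂ} (hw : 0 < w.re) (hy : 0 < w.im) :
    π / 2 - Real.arctan (w.re / w.im) ≤ (digamma w).im := by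
  have hs := hasSum_im_digamma hw
  -- rewrite the summand in real form
  have hs' : HasSum (fun k : ℕ ↦ w.im / ((w.re + k) ^ 2 + w.im ^ 2)) (digamma w).im := by
    refine hs.congr_fun fun k ↦ ?_
    rw [show (w + (k : ℂ)) = w + ((k : ℝ) : ℂ) by push_cast; ring, norm_add_ofReal_sq]
  -- every partial sum is a lower bound of the (nonnegative-term) series
  have hpart : ∀ n : ℕ, Real.arctan ((w.re + n) / w.im) - Real.arctan (w.re / w.im)
      ≤ (digamma w).im := by
    intro n
    refine (arctan_sub_arctan_le_sum hw hy n).trans ?_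
    exact sum_le_hasSum (Finset.range n) (fun k _ ↦ by positivity) hs'
  -- pass to the limit `n → ∞`
  have hlim : Tendsto (fun n : ℕ ↦ Real.arctan ((w.re + n) / w.im) - Real.arctan (w.re / w.im))
      atTop (𝓝 (π / 2 - Real.arctan (w.re / w.im))) := by
    refine Tendsto.sub_const ?_ _
    have h1 : Tendsto (fun n : ℕ ↦ (w.re + n) / w.im) atTop atTop := by
      refine Tendsto.atTop_div_const hy ?_
      exact tendsto_atTop_add_const_left _ _ tendsto_natCast_atTop_atTop
    exact (tendsto_nhds_of_tendsto_nhdsWithin Real.tendsto_arctan_atTop).comp h1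
  exact le_of_tendsto' hlim hpart

/-- Upper bound in the same shape: for `0 < Re w`, `0 < Im w`, `Im ψ(w) ≤ π/2 + Im w/‖w‖²`
(from `abs_im_digamma_le`). [folklore] -/
theorem im_digamma_le_pi_div_two_add {w : ℂ} (hw : 0 < w.re) (hy : 0 < w.im) :
    (digamma w).im ≤ π / 2 + w.im / ‖w‖ ^ 2 := by
  have h := abs_im_digamma_le hw hy.ne'
  rw [abs_of_pos hy] at h
  have := le_abs_self (digamma w).im
  linarith

/-- **Edge-value bound.** For `0 < Re w ≤ 1` and `0 < Im w`: `|Im ψ(w) − π/2| ≤ 1/Im w`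
(lower side: `arctan(Re w/Im w) ≤ Re w/Im w ≤ 1/Im w`; upper side: `Im w/‖w‖² ≤ Im w/(Im w)² = 1/Im w`).
At `Re w = 1/4` this is `|Im ψ(¼ + iy) − π/2| ≤ 1/y`, the form used for the archimedean Gram
entries of Weil's functional in a Fourier window basis [Yoshida 1992, (5.16)]. [folklore] -/
theorem abs_im_digamma_sub_pi_div_two_le {w : ℂ} (hw : 0 < w.re) (hw1 : w.re ≤ 1) (hy : 0 < w.im) :
    |(digamma w).im - π / 2| ≤ 1 / w.im := by
  rw [abs_le]
  constructor
  · -- lower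
    have h := pi_div_two_sub_arctan_le_im_digamma hw hy
    have ha : Real.arctan (w.re / w.im) ≤ w.re / w.im := by
      -- `arctan t ≤ t` for `t ≥ 0` (= `Literature.NumberTheory.LFunctions.arctan_le_self`, inlined to keep imports light)
      have h' := Real.le_tan (Real.arctan_nonneg.2 (div_nonneg hw.le hy.le))
        (Real.arctan_lt_pi_div_two _)
      rwa [Real.tan_arctan] at h'
    have hb : w.re / w.im ≤ 1 / w.im := div_le_div_of_nonneg_right hw1 hy.le
    linarith
  · -- upper
    have h := im_digamma_le_pi_div_two_add hw hy
    have hn : w.im ^ 2 ≤ ‖w‖ ^ 2 := by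
      rw [Complex.sq_norm, Complex.normSq_apply]
      nlinarith [sq_nonneg w.re]
    have hn0 : 0 < ‖w‖ ^ 2 := lt_of_lt_of_le (by positivity) hn
    have hb : w.im / ‖w‖ ^ 2 ≤ 1 / w.im := by
      rw [div_le_div_iff₀ hn0 hy]
      nlinarith
    linarith

end Summit.RiemannHypothesis.RiemannHypothesis.Theorems.WeilFormatC
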